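import Literature.Computability.QuantumComplexity.OraclePathSums
import Literature.Computability.QuantumComplexity.CountingSimulationRel
import Literature.Computability.QuantumComplexity.SqrtTwoDyadicThresholds
import Literature.Computability.Cryptography.QuantumCircuitProofs
import Literature.Computability.Complexity.OracleEmpty
import HarnessLib

/-!
# `BQP^A ⊆ AWPP^A` (Fortnow–Rogers 1999, Thm. 3.1 relativized): reduction to the counting of path pairs

Proof file (D-0014; no named facts) for the named fact `BQPRel_subset_AWPPRel` of
`CountingSimulationRel.lean` — "`BQP^A ⊆ AWPP^A` for every oracle language `A`" (L. Fortnow,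
J. Rogers, *Complexity limitations on quantum computation*, JCSS 59 (1999), Thm. 3.1 with
Lemma 3.2, and "Theorem 3.1 relativizes", §3 before Cor. 3.7 [FortnowRogers1999JCSS]) — and,
at the empty oracle, for `BQP_subset_AWPP` (`CountingSimulation.lean`).

Printed proof (Lemma 3.2 / Thm. 3.1): the acceptance probability of a polynomial-time quantum
machine on `x` is `f(x)/D(|x|)` with `f ∈ GapP` (sum over pairs of computation paths), for the
Bernstein–Vazirani normal form with rational amplitudes; hence `BQP ⊆ AWPP`. In the tree's model
(`BQPRel A`: uniform Clifford+`T` families with XOR-query gates, thresholds `2/3`, `1/3`;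
`AWPPRel O`: Fenner's dyadic `GapP^O` form with the same thresholds) the amplitudes live in
`ℤ[ω]/√2^h`, and the path-sum calculus WITH oracle gates of `OraclePathSums.lean` gives the
acceptance probability as `(2A + √2·B)/2^{h+1}` for the INTEGER pair counts `A = annSetA`,
`B = annSetB` of the accepting labels (`acceptProbOn_eq_sqrtTwoForm` below). The dyadic numerator
`g = 2^{k+1}A + ⌊2^k√2⌋B` of `SqrtTwoDyadicThresholds.lean` then satisfies the `AWPP^A` clauses
EXACTLY (`awppBounds_of_sqrtTwoForm`: `√2` is badly approximable, so no error reduction is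
needed). This file proves everything except the counting-machine statement, which it isolates as
the hypothesis of the final theorems:

* `abs_annSetB_le` (`|B_S| ≤ 4^{#gates}`), `annWeight_eq_sqrtTwoForm`;
* for a family `F`, oracle `A` and input `x`: the annotated gate list `accGas`, the input state
  `accInput`, the pair counts `accA`, `accB`, the Hadamard count `accH`, and
  `acceptProbOn_eq_sqrtTwoForm : F.acceptProbOn A x = (2·accA + √2·accB)/2^{accH+1}`;
* `accGap F A P x = dyadicGap (accA x) (accB x) (P |x| − accH x − 1)` — the candidate `GapP^A`
  numerator with denominator `2^{P |x|}` — and `accGap_clauses`: for `P |x| ≥ 5·#gates + 7` it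
  satisfies both `AWPP` clauses whenever the acceptance probability satisfies the `BQP` clauses;
* `exists_gapPoly`: a uniform family has such a polynomial `P` (polynomial size,
  `QCircuitFamily.IsUniform.isPolySize'`);
* `mem_AWPPRel_of_accGap`, **`BQPRel_subset_AWPPRel_of_accGap`** and `BQP_subset_AWPP_of_accGap`:
  the two named facts follow from the single counting statement
  `∀ F A p, F.IsUniform → accGap F A (p.eval ·) ∈ GapP^A` — i.e. that the signed, weighted count
  of pairs of annotated paths of the uniform circuit (a polynomial-time relation in `x` and the
  pair, with one oracle query per oracle gate and path) is a `GapP^A` function; its oracle-free,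
  unweighted analogue is the tree's `ADH.adhFn_mem_FP` (`ADHMachine.lean`, used for `BQP ⊆ PP`).

## References

* [FortnowRogers1999JCSS] L. Fortnow, J. Rogers, JCSS 59 (1999) (arXiv:cs/9811023): Lemma 3.2,
  Thm. 3.1, §3 (before Cor. 3.7).
* [AdlemanDeMarraisHuang1997] L. M. Adleman, J. DeMarrais, M.-D. A. Huang, *Quantum
  computability*, SIAM J. Comput. 26 (1997), §6, Lemma 6.10 (pairs of paths).
* [Fenner2003] S. Fenner, *PP-lowness and a simple definition of AWPP*, Theory Comput. Syst. 36
  (2003), Thm. 1.2.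
-/

noncomputable section

namespace Literature.Computability.QuantumComplexity

open _root_.Computability Complexity Complexity.Classes Cryptography SqrtTwoDyadic

/-! ### Bounds on the pair counts and the set weight as a `√2`-form -/

section PairCounts

variable {N : ℕ}

/-- `|reB d| ≤ 1`. [folklore] -/
theorem abs_reB_le_one (d : ℕ) : |reB d| ≤ 1 := by
  unfold reB
  split <;> simp

/-- `|reA d| ≤ 1`. [folklore] -/
theorem abs_reA_le_one (d : ℕ) : |reA d| ≤ 1 := by
  unfold reA
  split <;> simp

/-- **`|B_S| ≤ 4^{#gates}`**: the pair count is a sum of `4^{#gates}` terms in `{0, ±1}`. [folklore] -/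
theorem abs_annSetB_le (gas : List (AnnGate N)) (w : QReg N) (S : Set (QReg N)) :
    |annSetB gas w S| ≤ (4 : ℤ) ^ gas.length := by
  classical
  unfold annSetB
  refine (Finset.abs_sum_le_sum_abs _ _).trans ?_
  refine (Finset.sum_le_sum fun b _ => Finset.abs_sum_le_sum_abs _ _).trans ?_
  have hterm : ∀ b b' : Fin gas.length → Bool,
      |(match annPathRun gas w (List.ofFn b), annPathRun gas w (List.ofFn b') with
        | some (z₁, φ), some (z₂, φ') => if z₁ = z₂ ∧ z₁ ∈ S then reB ((φ + 7 * φ') % 8) else 0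
        | _, _ => (0 : ℤ))| ≤ 1 := by
    intro b b'
    rcases annPathRun gas w (List.ofFn b) with _ | ⟨z₁, φ⟩ <;>
      rcases annPathRun gas w (List.ofFn b') with _ | ⟨z₂, φ'⟩
    · simp
    · simp
    · simp
    · simp only
      split_ifs
      · exact abs_reB_le_one _
      · simp
  refine (Finset.sum_le_sum fun b _ => Finset.sum_le_sum fun b' _ => hterm b b').trans (le_of_eq ?_)
  simp only [Finset.sum_const, Finset.card_univ, Fintype.card_fun, Fintype.card_bool,
    Fintype.card_fin, nsmul_eq_mul, mul_one]
  push_cast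
  rw [← mul_pow]
  norm_num

/-- `|B_S| ≤ 2^{2·#gates}`. [folklore] -/
theorem abs_annSetB_le_two_pow (gas : List (AnnGate N)) (w : QReg N) (S : Set (QReg N)) :
    |annSetB gas w S| ≤ (2 : ℤ) ^ (2 * gas.length) := by
  rw [pow_mul]
  norm_num
  exact abs_annSetB_le gas w S

/-- **The set weight is the `√2`-form of its pair counts**: `W(S) = (2A_S + √2 B_S)/2^{h+1}`
(`two_pow_mul_annWeight` rewritten). [cite: AdlemanDeMarraisHuang1997, §6 Lemma 6.10 (proof)] -/
theorem annWeight_eq_sqrtTwoForm (gas : List (AnnGate N)) (w : QReg N) (S : Set (QReg N)) :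
    annWeight gas w S = sqrtTwoForm (annSetA gas w S) (annSetB gas w S) (annHCount gas) := by
  have h := two_pow_mul_annWeight gas w S
  have h2 : (0 : ℝ) < 2 ^ annHCount gas := by positivity
  unfold sqrtTwoForm
  rw [eq_div_iff (by positivity), pow_succ]
  linear_combination (2 : ℝ) * h

end PairCounts

/-! ### The acceptance probability of a family as a `√2`-form -/

section Family

variable (F : QCircuitFamily cliffordT) (A : Language Bool)

/-- The gate list of `F` at length `|x|`, every gate annotated with the oracle `A`. [folklore] -/
def accGas (x : List Bool) : List (AnnGate (x.length + F.ancillas x.length)) :=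
  (F.circ x.length).gates.map fun g => (g, A)

/-- The input basis label `x 0^m`. [folklore] -/
def accInput (x : List Bool) : QReg (x.length + F.ancillas x.length) :=
  padInput x.get (F.ancillas x.length)

/-- The integer pair count `A` of the accepting labels. [cite: AdlemanDeMarraisHuang1997, §6 Lemma 6.10] -/
def accA (x : List Bool) : ℤ :=
  annSetA (accGas F A x) (accInput F x) (QCircuit.acceptEvent _)

/-- The `√2/2` pair count `B` of the accepting labels. [cite: AdlemanDeMarraisHuang1997, §6 Lemma 6.10] -/
def accB (x : List Bool) : ℤ :=
  annSetB (accGas F A x) (accInput F x) (QCircuit.acceptEvent _)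

/-- The number of Hadamard gates of the circuit at length `|x|`. [folklore] -/
def accH (x : List Bool) : ℕ :=
  annHCount (accGas F A x)

/-- The annotated gate list has the circuit's length. [folklore] -/
@[simp] theorem length_accGas (x : List Bool) : (accGas F A x).length = (F.circ x.length).gates.length := by
  simp [accGas]

/-- `h ≤ #gates`. [folklore] -/
theorem accH_le (x : List Bool) : accH F A x ≤ (F.circ x.length).gates.length := by
  simpa [accH] using annHCount_le_length (accGas F A x)

/-- `|B| ≤ 2^{2·#gates}`. [folklore] -/
theorem abs_accB_le (x : List Bool) : |accB F A x| ≤ (2 : ℤ) ^ (2 * (F.circ x.length).gates.length) := by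
  simpa [accB] using abs_annSetB_le_two_pow (accGas F A x) (accInput F x) (QCircuit.acceptEvent _)

/-- **The acceptance probability is the weight of the accepting labels** in the annotated path-sum
model (constant annotation `A`: `annProd_map_const`). [cite: AdlemanDeMarraisHuang1997, §6 Lemma 6.10] -/
theorem acceptProbOn_eq_annWeight (x : List Bool) :
    F.acceptProbOn A x = annWeight (accGas F A x) (accInput F x) (QCircuit.acceptEvent _) := by
  classical
  unfold QCircuitFamily.acceptProbOn
  rw [QCircuit.acceptProb_eq_probEvent]
  unfold QCircuit.probEvent annWeight QCircuit.runOn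
  rw [Finset.sum_filter, accGas, annProd_map_const]
  rfl

/-- **`Pr[F^A accepts x] = (2·accA + √2·accB)/2^{accH + 1}`.** [cite: FortnowRogers1999JCSS, Lemma 3.2 (arXiv numbering)] [cite: AdlemanDeMarraisHuang1997, §6 Lemma 6.10] -/
theorem acceptProbOn_eq_sqrtTwoForm (x : List Bool) :
    F.acceptProbOn A x = sqrtTwoForm (accA F A x) (accB F A x) (accH F A x) := by
  rw [acceptProbOn_eq_annWeight, annWeight_eq_sqrtTwoForm]
  rfl

/-- **The candidate `GapP^A` numerator**: `accGap F A P x = 2^{k+1}·accA x + ⌊2^k√2⌋·accB x` with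
`k = P |x| − accH x − 1`, so that its denominator exponent `accH + 1 + k` is `P |x|`.
[cite: FortnowRogers1999JCSS, Lemma 3.2 (arXiv numbering)] -/
def accGap (P : ℕ → ℕ) (x : List Bool) : ℤ :=
  dyadicGap (accA F A x) (accB F A x) (P x.length - (accH F A x + 1))

/-- **The `AWPP` clauses for `accGap`** at an input where the denominator exponent is large
enough (`5·#gates + 7 ≤ P |x|`): if `Pr ≥ 2/3` then `2·2^{P|x|} ≤ 3g ≤ 3·2^{P|x|}`, and if `Pr ≤ 1/3`
then `0 ≤ 3g ≤ 2^{P|x|}`. [cite: FortnowRogers1999JCSS, Thm. 3.1 (arXiv numbering)] [cite: Fenner2003, Thm. 1.2] -/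
theorem accGap_clauses (P : ℕ → ℕ) (x : List Bool)
    (hP : 5 * (F.circ x.length).gates.length + 7 ≤ P x.length) :
    (2 / 3 ≤ F.acceptProbOn A x →
        2 * (2 : ℤ) ^ P x.length ≤ 3 * accGap F A P x ∧ accGap F A P x ≤ (2 : ℤ) ^ P x.length) ∧
    (F.acceptProbOn A x ≤ 1 / 3 →
        0 ≤ accGap F A P x ∧ 3 * accGap F A P x ≤ (2 : ℤ) ^ P x.length) := by
  have hh := accH_le F A x
  have hk : 2 * (2 * (F.circ x.length).gates.length) + 6 ≤ P x.length - (accH F A x + 1) := by omega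
  have hPk : accH F A x + 1 + (P x.length - (accH F A x + 1)) = P x.length := by omega
  have h := awppBounds_of_sqrtTwoForm (accA F A x) (accB F A x) (accH F A x)
    (P x.length - (accH F A x + 1)) (2 * (F.circ x.length).gates.length) (abs_accB_le F A x) hk
    (by rw [← acceptProbOn_eq_sqrtTwoForm]; exact QCircuitFamily.acceptProbOn_nonneg A F x)
    (by rw [← acceptProbOn_eq_sqrtTwoForm, acceptProbOn_eq_annWeight]; exact annWeight_le_one _ _ _)
  rw [hPk, ← acceptProbOn_eq_sqrtTwoForm] at h
  exact h

/-- **A uniform family has a polynomial denominator exponent** `P` with `5·#gates(n) + 7 ≤ P(n)`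
(polynomial size from uniformity, `QCircuitFamily.IsUniform.isPolySize'`). [cite: AroraBarak2009, Def. 6.12 & Thm. 6.13] -/
theorem exists_gapPoly (hU : F.IsUniform) :
    ∃ p : Polynomial ℕ, ∀ n : ℕ, 5 * (F.circ n).gates.length + 7 ≤ p.eval n := by
  obtain ⟨s, hs⟩ := QCircuitFamily.IsUniform.isPolySize' hU
  refine ⟨5 * s + 7, fun n => ?_⟩
  have h := (hs n).1
  simp only [Polynomial.eval_add, Polynomial.eval_mul, Polynomial.eval_ofNat]
  unfold QCircuit.size at h
  omega

/-- **`AWPP^A`-membership from the counting statement**: if `F` decides `L` relative to `A` with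
the `BQP` thresholds and `accGap F A p` is a `GapP^A` function for a polynomial `p` dominating
`5·#gates + 7`, then `L ∈ AWPP^A`. [cite: FortnowRogers1999JCSS, Thm. 3.1 (arXiv numbering)] [cite: Fenner2003, Thm. 1.2] -/
theorem mem_AWPPRel_of_accGap {L : Language Bool}
    (hFL : ∀ x, (x ∈ L → 2 / 3 ≤ F.acceptProbOn A x) ∧ (x ∉ L → F.acceptProbOn A x ≤ 1 / 3))
    (p : Polynomial ℕ) (hp : ∀ n, 5 * (F.circ n).gates.length + 7 ≤ p.eval n)
    (hg : accGap F A (fun n => p.eval n) ∈ GapPRel (Oracle.ofLanguage A)) :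
    L ∈ AWPPRel (Oracle.ofLanguage A) := by
  refine mem_AWPPRel_iff.2 ⟨_, hg, p, fun x => ?_⟩
  have h := accGap_clauses F A (fun n => p.eval n) x (hp x.length)
  exact ⟨fun hx => h.1 ((hFL x).1 hx), fun hx => h.2 ((hFL x).2 hx)⟩

end Family

/-! ### The named facts from the counting statement -/

/-- **`BQP^A ⊆ AWPP^A` from the counting statement** "for every uniform Clifford+`T` family `F`,
oracle `A` and polynomial `p`, `accGap F A p ∈ GapP^A`" (the relativized pair-counting machine of
Lemma 3.2 / Adleman–DeMarrais–Huang Lemma 6.10). [cite: FortnowRogers1999JCSS, Thm. 3.1, Lemma 3.2 and §3 before Cor. 3.7 (arXiv numbering)] -/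
theorem BQPRel_subset_AWPPRel_of_accGap
    (hgap : ∀ (F : QCircuitFamily cliffordT) (A : Language Bool) (p : Polynomial ℕ), F.IsUniform →
      accGap F A (fun n => p.eval n) ∈ GapPRel (Oracle.ofLanguage A)) :
    BQPRel_subset_AWPPRel := by
  rintro A L ⟨F, hU, hFL⟩
  obtain ⟨p, hp⟩ := exists_gapPoly F hU
  exact mem_AWPPRel_of_accGap F A hFL p hp (hgap F A p hU)

/-- **`BQP ⊆ AWPP` from the same counting statement** (at the empty oracle, `PRel_empty_holds`).
[cite: FortnowRogers1999JCSS, Thm. 3.1 (arXiv numbering)] -/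
theorem BQP_subset_AWPP_of_accGap
    (hgap : ∀ (F : QCircuitFamily cliffordT) (A : Language Bool) (p : Polynomial ℕ), F.IsUniform →
      accGap F A (fun n => p.eval n) ∈ GapPRel (Oracle.ofLanguage A)) :
    BQP_subset_AWPP :=
  BQP_subset_AWPP_of_BQPRel_subset_AWPPRel (BQPRel_subset_AWPPRel_of_accGap hgap) PRel_empty_holds

end Literature.Computability.QuantumComplexity

end
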